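import Mathlib
import Summits.Ventures.FusionMHD.Models.CerfonFreidbergIterLikeQHalfMercDefs
import HarnessLib

/-!
# Ventures/FusionMHD — Models/CerfonFreidbergIterLikeQHalfMercPanels4.lean: KERNEL CHECK of the Mercier-register certificates of panel(s) 4, 5 (of 32)
# at `ψ_N = 1/2` of THE Cerfon–Freidberg ITER-like instance

HONEST FRAMING (LADDER-GRIDFUSION three columns; CF rung; «F2.R2-CF-MERCIER-IMPLICIT» step (2), F2-SCOPING v1.6 §10(c)).  One `decide +kernel` (≈ 100 s): for each
listed panel the obligation `CFIterLike.QHalfMerc.MercCert.ok` (`Models/CerfonFreidbergIterLikeQHalfMercDefs.lean`) — the Taylor-model run of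
`progM = progA ++ block1 ++ block2 ++ block3M` over ★ #117's parameter box is ACCEPTED (both `inv` certificates included) and the kernel's FOUR panel-integral
enclosures (`g_W`, `g_Aσ`, `g_AR`, `g_B1` along the approximant) lie inside the claimed integers (read off a compiled `#eval` of the same functions, slack one unit of
`2⁻⁶⁰`; float truth inside every panel, `HOME/models/model-7/g7/genqm/truthM.json`).  MODELLED: analytic Cerfon–Freidberg family; nothing about a device or
stability.  No `native_decide`.  Typer/prover: gridfusion-model-7 (g7), 2026-08-27.
Citations: Jardin 2010 §8.5 (8.134) [Jardin2010]; Mahboubi–Melquiond–Sibut-Pinote 2016 §3.2 Lemma 3 [MahboubiMelquiondSibutpinote2016].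
-/

namespace Summit.Ventures.FusionMHD.Models.CFIterLike.QHalfMerc

/-- Mercier-register certificate data of panel(s) 4, 5. [instance data] -/
def mercCert4 : List MercCert := [
  { j := 4, cand1 := [108480286632410759168, 216509018897923964928, 1041217257826832351232, 2223391253096127791104, 6842061410766530019328, 15362200586546336235520, 38845600046945149124608, 83987875500792483938304, -5278130751031964860416, -1862680438595158768877568, 619759244057556586642538496, 3281798601207860352312672256, -778778086325556381674335371264],
    cand2 := [127681345394439962624, 154550276691744948224, 739639616833303347200, 1572130280712925872128, 4973777675757145817088, 11712184781042373099520, 30520525267406099054592, 70733795225321475145728, 194158119878063428730880, -3922194320547322158645248, -48744563532661292919685120, 4708523330618547890674466816, -5064617805282219982994800640],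
    deg := 10, e1 := 42, e2 := 42, wlo := -372818814127706414, whi := -372818716481924835, slo := 4017335014472923160, shi := 4017335311933615377,
    rlo := 6128678434947713485, rhi := 6128678897507521624, blo := 2633366707786164226, bhi := 2633366900477305365 },
  { j := 5, cand1 := [116337881404870803456, 289014935329021001728, 1295051234626762178560, 3255481473900758433792, 9913724120429540409344, 24709392550004873232384, 63059987032626077630464, 143076421757474382544896, 501194581417686854533120, 5649330979295429549621248, -727376638559330436888133632, -8590340253233749676324290560, 1059309487091443221872852860928],
    cand2 := [133286446489051561984, 206052554179893624832, 920229102792823013376, 2329478381989580242944, 7337364463869774266368, 19183370299313905205248, 51177593722339917299712, 126865077685829230395392, 511436423554187621564416, -3423246604291691163680768, -815752213385136401287217152, 4895618893508458071969497088, 1177451952750900551899559231488],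
    deg := 10, e1 := 42, e2 := 42, wlo := -447635430992796891, whi := -447635325940401356, slo := 4260233362237284780, shi := 4260233665203756825,
    rlo := 6443446526821107822, rhi := 6443446994452243869, blo := 2816773609974698469, bhi := 2816773808094331356 }]

/-- **KERNEL CHECK** of the four Mercier registers on panel(s) 4, 5. -/
theorem mercCert4_ok : CFIterLike.QHalfMerc.mercCert4.all MercCert.ok = true := by
  decide +kernel

end Summit.Ventures.FusionMHD.Models.CFIterLike.QHalfMerc
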